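import Summits.ValiantsHypothesis.ValiantsHypothesis.Theorems.SymPencilPerFourInnerRankHypPurity
import Summits.ValiantsHypothesis.ValiantsHypothesis.Theorems.SymPencilPerFourOneRowPoint

/-!
# Route `SymPencil` — inner rank of the `2 | 2` row split of `per_4` on a SUBSPACE of the
# `u`-side, IV: the pure-case endgame (`--supports` stmt-ValiantsHypothesis-5674
# `SdcSuperquadratic`; toward IR9U/IR9H = cell `(9, 7, 8)` of the size-`27` table; rung currency only)

Setting as in `SymPencilPerFourInnerRankHypFamily/HypPairs`: `hJ` on a submodule `U ≤ K⁴ × K⁴`,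
a linear section `ρ` of the second projection into `U`, `H_a = {a : (a, 0) ∈ U}`,
`H_b = {b : (0, b) ∈ U}` (both of dimension `≥ 3` when `dim U = 7`).

* **`false_of_allA_U`** — THE PURE CASE on a subspace: if all columns are `τ`-pure on `H_a × 0`,
  `n_jj = 0` and `n_{x0} = n_{0x}` for the vectors `n_{jk} = (t_r(ρ e_j, (e_k, 0)))_r`, then the
  SYMMETRISED vectors `n̄_S = n_{jk} + n_{kj}` (`S = {j,k}`) span a `6`-dimensional totally
  isotropic subspace for `⟨x, y⟩ = Σ c_r x_r y_r` (isotropy needs only polarisation, `n_jj = 0`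
  and the star symmetry at `0`), paired perfectly with the `m_{a,l} = (t_r((a,0),(0,e_l)))_r`,
  `a ∈ H_a`, through `2⟨n̄_S, m_{a,l}⟩ = 2 per (a; e_j; e_k; e_l)` (`kappa_eq_zero` twice); so
  `6 ≤ |ι| - 6`, impossible for `|ι| ≤ 9`.

Honest framing: lemmas toward IR9U; cell `(9,7,8)` not killed here; `27 ≤ sdc(per_4) ≤ 29`
unchanged; the crux `SdcSuperquadratic` and `VP ≠ VNP` untouched.  No definitions. [folklore]
-/

noncomputable section

-- single-conjunct layout: Sub = Summit, duplicated namespace component intended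
set_option linter.dupNamespace false

namespace Summit.ValiantsHypothesis.ValiantsHypothesis.Theorems.SymPencilPerFourInnerRankHypNine

open Matrix Finset Module
open Summit.ValiantsHypothesis.ValiantsHypothesis.Theorems.SymPencilPerFourInnerRankRows
open Summit.ValiantsHypothesis.ValiantsHypothesis.Theorems.SymPencilPerFourInnerRankHypFamily
open Summit.ValiantsHypothesis.ValiantsHypothesis.Theorems.SymPencilPerFourInnerRankHypPairs
open Summit.ValiantsHypothesis.ValiantsHypothesis.Theorems.SymPencilPerFourInnerRankHypPurity

variable {K : Type*} [Field K] {ι : Type*} [Fintype ι]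

/-! ### The pure case on a subspace -/

/-- **The pure case is impossible on a subspace.**  See the module docstring. [folklore] -/
theorem false_of_allA_U [CharZero K] [DecidableEq ι] (hι : Fintype.card ι ≤ 9) (c : ι → K)
    (t : ι → (((Fin 4 → K) × (Fin 4 → K)) →ₗ[K] ((Fin 4 → K) × (Fin 4 → K)) →ₗ[K] K))
    (U : Submodule K ((Fin 4 → K) × (Fin 4 → K)))
    (hJ : ∀ u ∈ U, ∀ y₂ y₃ : Fin 4 → K,
      ∑ r, c r * (t r u (y₂, y₃)) ^ 2 = (Matrix.of ![u.1, u.2, y₂, y₃]).permanent)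
    (ρ : (Fin 4 → K) →ₗ[K] ((Fin 4 → K) × (Fin 4 → K))) (hρ2 : ∀ b, (ρ b).2 = b)
    (hρU : ∀ b, ρ b ∈ U)
    (hUa : 3 ≤ finrank K (U.comap (LinearMap.inl K (Fin 4 → K) (Fin 4 → K))))
    (hX : ∀ k : Fin 4, ∀ a : Fin 4 → K, ((a, (0 : Fin 4 → K)) : (Fin 4 → K) × (Fin 4 → K)) ∈ U →
      ∀ r, t r (a, 0) (Pi.single k 1, 0) = 0)
    (hn : ∀ j : Fin 4, ∀ r, t r (ρ (Pi.single j 1)) (Pi.single j 1, 0) = 0)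
    (hsym : ∀ x : Fin 4, x ≠ 0 → ∀ r,
      t r (ρ (Pi.single x 1)) (Pi.single 0 1, 0) = t r (ρ (Pi.single 0 1)) (Pi.single x 1, 0)) :
    False := by
  set Ha := U.comap (LinearMap.inl K (Fin 4 → K) (Fin 4 → K)) with hHa
  have hmemA : ∀ a, a ∈ Ha ↔ ((a, (0 : Fin 4 → K)) : (Fin 4 → K) × (Fin 4 → K)) ∈ U :=
    fun a => Submodule.mem_comap
  -- the vectors `n_{jk}`, `m_{a,l}` and the pairing `B`
  set n : Fin 4 → Fin 4 → ι → K := fun j k r => t r (ρ (Pi.single j 1)) (Pi.single k 1, 0)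
    with hn_def
  set m : (Fin 4 → K) → Fin 4 → ι → K := fun a l r => t r (a, 0) (0, Pi.single l 1) with hm_def
  set B : (ι → K) → (ι → K) → K := fun x y => ∑ r, c r * x r * y r with hB
  have Bsymm : ∀ x y, B x y = B y x := fun x y => Finset.sum_congr rfl fun r _ => by ring
  have Badd₁ : ∀ x y z, B (x + y) z = B x z + B y z := fun x y z => by
    simp only [hB, Pi.add_apply, mul_add, add_mul, Finset.sum_add_distrib]
  have Badd₂ : ∀ x y z, B x (y + z) = B x y + B x z := fun x y z => by
    simp only [hB, Pi.add_apply, mul_add, Finset.sum_add_distrib]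
  have njj : ∀ j, n j j = 0 := fun j => funext (hn j)
  have nsym0 : ∀ x, n x 0 = n 0 x := fun x => by
    by_cases hx : x = 0
    · rw [hx]
    · exact funext (hsym x hx)
  -- polarisation at `ρ e_j` and at `(a, 0) + ρ e_j`
  have hpolρ : ∀ j (v w v' w' : Fin 4 → K),
      2 * ∑ r, c r * t r (ρ (Pi.single j 1)) (v, w) * t r (ρ (Pi.single j 1)) (v', w') =
        (Matrix.of ![(ρ (Pi.single j 1)).1, Pi.single j 1, v, w']).permanent +
        (Matrix.of ![(ρ (Pi.single j 1)).1, Pi.single j 1, v', w]).permanent := fun j v w v' w' => by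
    have := polar_U c t U hJ _ (hρU (Pi.single j 1)) v w v' w'
    rwa [hρ2] at this
  -- gram pairing against the `m`'s
  have gram : ∀ a : Fin 4 → K, ((a, (0 : Fin 4 → K)) : (Fin 4 → K) × (Fin 4 → K)) ∈ U →
      ∀ j k l : Fin 4, 2 * B (n j k) (m a l) =
        (Matrix.of ![a, Pi.single j 1, Pi.single k 1, Pi.single l 1]).permanent := by
    intro a ha j k l
    have hu : ((a, (0 : Fin 4 → K)) : (Fin 4 → K) × (Fin 4 → K)) + ρ (Pi.single j 1) ∈ U :=
      U.add_mem ha (hρU _)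
    have h := polar_U c t U hJ _ hu (Pi.single k 1) 0 0 (Pi.single l 1)
    have h' := hpolρ j (Pi.single k 1) 0 0 (Pi.single l 1)
    simp only [Prod.fst_add, Prod.snd_add, hρ2, zero_add, per_zero_row₂, add_zero] at h h'
    rw [SymPencilPerFourOneRowPoint.per_add_row₀] at h
    have hs1 : ∀ r, t r ((a, 0) + ρ (Pi.single j 1)) (Pi.single k 1, 0) = n j k r := fun r => by
      rw [map_add, LinearMap.add_apply, hX k a ha r, zero_add]
    have hs2 : ∀ r, t r ((a, 0) + ρ (Pi.single j 1)) (0, Pi.single l 1) =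
        m a l r + t r (ρ (Pi.single j 1)) (0, Pi.single l 1) := fun r => by
      rw [map_add, LinearMap.add_apply]
    simp_rw [hs1, hs2] at h
    have hexp : ∑ r, c r * n j k r * (m a l r + t r (ρ (Pi.single j 1)) (0, Pi.single l 1)) =
        B (n j k) (m a l) + ∑ r, c r * n j k r * t r (ρ (Pi.single j 1)) (0, Pi.single l 1) := by
      rw [hB, ← Finset.sum_add_distrib]
      exact Finset.sum_congr rfl fun r _ => by ring
    rw [hexp] at h
    linear_combination h - h'
  -- isotropy relations among the `n`'s
  have iso : ∀ j j' k k' : Fin 4, B (n j k) (n j' k') + B (n j' k) (n j k') = 0 := by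
    intro j j' k k'
    have hd : ∀ jj : Fin 4, B (n jj k) (n jj k') = 0 := fun jj => by
      have h' := hpolρ jj (Pi.single k 1) 0 (Pi.single k' 1) 0
      rw [per_zero_row₃, per_zero_row₃, add_zero] at h'
      exact (mul_eq_zero.1 h').resolve_left two_ne_zero
    have h := polar_U c t U hJ _ (hρU (Pi.single j 1 + Pi.single j' 1)) (Pi.single k 1) 0
      (Pi.single k' 1) 0
    rw [per_zero_row₃, per_zero_row₃, add_zero] at h
    have h1 : ∀ r (kk : Fin 4), t r (ρ (Pi.single j 1 + Pi.single j' 1)) (Pi.single kk 1, 0) =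
        n j kk r + n j' kk r := fun r kk => by
      rw [map_add, map_add, LinearMap.add_apply]
    simp_rw [h1] at h
    have hexp : ∑ r, c r * (n j k r + n j' k r) * (n j k' r + n j' k' r) =
        B (n j k) (n j k') + (B (n j k) (n j' k') + B (n j' k) (n j k')) + B (n j' k) (n j' k') := by
      rw [hB, ← Finset.sum_add_distrib, ← Finset.sum_add_distrib, ← Finset.sum_add_distrib]
      exact Finset.sum_congr rfl fun r _ => by ring
    rw [hexp, hd j, hd j', zero_add, add_zero] at h
    exact (mul_eq_zero.1 h).resolve_left two_ne_zero
  -- two `n`'s sharing an index are orthogonal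
  have sh1 : ∀ j k k', B (n j k) (n j k') = 0 := fun j k k' => by
    have h := iso j j k k'
    linear_combination h / 2
  have sh2 : ∀ j k j', B (n j k) (n j' k) = 0 := fun j k j' => by
    have h := iso j j' k k
    rw [Bsymm (n j' k)] at h
    linear_combination h / 2
  have sh3 : ∀ j k k', B (n j k) (n k k') = 0 := fun j k k' => by
    have h := iso j k k k'
    rwa [njj, show B 0 (n j k') = 0 by simp [hB], add_zero] at h
  -- the symmetrised vectors
  set nb : Fin 4 → Fin 4 → ι → K := fun j k => n j k + n k j with hnb
  clear_value nb
  have barShared : ∀ j k j' k', (j = j' ∨ j = k' ∨ k = j' ∨ k = k') →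
      B (nb j k) (nb j' k') = 0 := by
    rintro j k j' k' (rfl | rfl | rfl | rfl)
    · simp only [hnb, Badd₁, Badd₂]
      rw [sh1 j k k', Bsymm (n j k) (n k' j), sh3 k' j k, sh3 k j k', sh2 k j k']; ring
    · simp only [hnb, Badd₁, Badd₂]
      rw [Bsymm (n j k) (n j' j), sh3 j' j k, sh1 j k j', sh2 k j j', sh3 k j j']; ring
    · simp only [hnb, Badd₁, Badd₂]
      rw [sh3 j k k', sh2 j k k', sh1 k j k', Bsymm (n k j) (n k' k), sh3 k' k j]; ring
    · simp only [hnb, Badd₁, Badd₂]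
      rw [sh2 j k j', sh3 j k j', Bsymm (n k j) (n j' k), sh3 j' k j, sh1 k j j']; ring
  have barDisj : ∀ x y z, B (nb 0 x) (nb y z) = 0 := by
    intro x y z
    have e1 := iso x y 0 z
    have e2 := iso 0 x y z
    have e3 := iso x z 0 y
    rw [nsym0 x, nsym0 y] at e1
    rw [nsym0 x, nsym0 z] at e3
    rw [Bsymm (n x y) (n 0 z)] at e2
    simp only [hnb, Badd₁, Badd₂]
    rw [nsym0 x]
    linear_combination 2 * e1 - 2 * e2 + 2 * e3
  set N6 : Fin 6 → ι → K := ![nb 0 1, nb 0 2, nb 0 3, nb 1 2, nb 1 3, nb 2 3] with hN6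
  clear_value N6
  have h6 : ∀ S : Fin 6, S = 0 ∨ S = 1 ∨ S = 2 ∨ S = 3 ∨ S = 4 ∨ S = 5 := by decide
  have iso6 : ∀ S S' : Fin 6, B (N6 S) (N6 S') = 0 := by
    intro S S'
    rcases h6 S with rfl | rfl | rfl | rfl | rfl | rfl <;>
      rcases h6 S' with rfl | rfl | rfl | rfl | rfl | rfl <;>
      simp only [hN6, Matrix.cons_val] <;>
      first
        | exact barShared _ _ _ _ (by decide)
        | exact barDisj _ _ _
        | (rw [Bsymm]; exact barDisj _ _ _)
  -- gram for the symmetrised vectors: `2 B (N6 S) (m a l) = 2 per (a; e_j; e_k; e_l)`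
  have gram6 : ∀ a : Fin 4 → K, ((a, (0 : Fin 4 → K)) : (Fin 4 → K) × (Fin 4 → K)) ∈ U →
      ∀ (l : Fin 4) (S : Fin 6), B (N6 S) (m a l) =
        (Matrix.of ![a, Pi.single ((![0, 0, 0, 1, 1, 2] : Fin 6 → Fin 4) S) (1 : K),
          Pi.single ((![1, 2, 3, 2, 3, 3] : Fin 6 → Fin 4) S) 1, Pi.single l 1]).permanent := by
    intro a ha l S
    have key : ∀ j k, B (nb j k) (m a l) =
        (Matrix.of ![a, Pi.single j 1, Pi.single k 1, Pi.single l 1]).permanent := fun j k => by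
      simp only [hnb, Badd₁]
      have h1 := gram a ha j k l
      have h2 := gram a ha k j l
      rw [per_swap_row₁₂] at h2
      linear_combination (h1 + h2) / 2
    rcases h6 S with rfl | rfl | rfl | rfl | rfl | rfl <;>
      simp only [hN6, Matrix.cons_val] <;> exact key _ _
  -- the kappa argument: a functional vanishing on all `(B (N6 S) (m a l))_S` vanishes
  have hκ : ∀ κ : Fin 6 → K, (∀ a : Fin 4 → K, ((a, (0 : Fin 4 → K)) : (Fin 4 → K) × (Fin 4 → K)) ∈ U →
      ∀ l : Fin 4, ∑ S, κ S * B (N6 S) (m a l) = 0) → κ = 0 := by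
    intro κ hκ0
    refine kappa_eq_zero Ha hUa κ ?_ ?_ ?_ ?_ <;> intro a ha <;> rw [hmemA] at ha
    · have h := hκ0 a ha 0
      simp_rw [gram6 a ha, fun S => (per_single_table a S).1] at h
      simp [Fin.sum_univ_succ] at h
      linear_combination h
    · have h := hκ0 a ha 1
      simp_rw [gram6 a ha, fun S => (per_single_table a S).2.1] at h
      simp [Fin.sum_univ_succ] at h
      linear_combination h
    · have h := hκ0 a ha 2
      simp_rw [gram6 a ha, fun S => (per_single_table a S).2.2.1] at h
      simp [Fin.sum_univ_succ] at h
      linear_combination h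
    · have h := hκ0 a ha 3
      simp_rw [gram6 a ha, fun S => (per_single_table a S).2.2.2] at h
      simp [Fin.sum_univ_succ] at h
      linear_combination h
  -- `ψ x = (B (N6 S) x)_S` is onto `K⁶`
  let ψ : (ι → K) →ₗ[K] (Fin 6 → K) :=
    { toFun := fun x S => B (N6 S) x
      map_add' := fun x y => by
        funext S
        simp only [hB, Pi.add_apply, mul_add, Finset.sum_add_distrib]
      map_smul' := fun s x => by
        funext S
        simp only [hB, Pi.smul_apply, smul_eq_mul, RingHom.id_apply, Finset.mul_sum]
        exact Finset.sum_congr rfl fun r _ => by ring }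
  have hψ : ∀ x S, ψ x S = B (N6 S) x := fun x S => rfl
  have hsum : ∀ v : Fin 6 → K, ∑ S, v S • (Pi.single S (1 : K) : Fin 6 → K) = v := fun v => by
    funext S
    simp [Finset.sum_apply, Pi.single_apply]
  have hrange : LinearMap.range ψ = ⊤ := by
    by_contra hne
    obtain ⟨f, hf0, hle⟩ := Submodule.exists_le_ker_of_lt_top _ (lt_top_iff_ne_top.2 hne)
    apply hf0
    have hfv : ∀ v : Fin 6 → K, f v = ∑ S, v S * f (Pi.single S 1) := fun v => by
      conv_lhs => rw [← hsum v]
      rw [map_sum]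
      exact Finset.sum_congr rfl fun S _ => by rw [map_smul, smul_eq_mul]
    have hz : (fun S => f (Pi.single S 1)) = 0 := by
      refine hκ _ fun a ha l => ?_
      have hmem : ψ (m a l) ∈ LinearMap.ker f := hle (LinearMap.mem_range_self ψ _)
      rw [LinearMap.mem_ker, hfv] at hmem
      rw [← hmem]
      exact Finset.sum_congr rfl fun S _ => by rw [hψ]; ring
    refine LinearMap.ext fun v => ?_
    rw [hfv, LinearMap.zero_apply]
    exact Finset.sum_eq_zero fun S _ => by
      rw [show f (Pi.single S 1) = 0 from congr_fun hz S, mul_zero]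
  have hker : finrank K (LinearMap.ker ψ) + 6 = Fintype.card ι := by
    have h := LinearMap.finrank_range_add_finrank_ker ψ
    rw [hrange, finrank_top, finrank_fintype_fun_eq_card, finrank_fintype_fun_eq_card,
      Fintype.card_fin] at h
    omega
  -- the `N6 S` are linearly independent and lie in `ker ψ`
  have Blin : ∀ (y : ι → K) (g : Fin 6 → K), B (∑ S, g S • N6 S) y = ∑ S, g S * B (N6 S) y := by
    intro y g
    let Bl : (ι → K) →ₗ[K] K :=
      { toFun := fun x => B x y
        map_add' := fun x x' => Badd₁ x x' y
        map_smul' := fun s x => by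
          simp only [hB, Pi.smul_apply, smul_eq_mul, RingHom.id_apply, Finset.mul_sum]
          exact Finset.sum_congr rfl fun r _ => by ring }
    change Bl (∑ S, g S • N6 S) = ∑ S, g S * Bl (N6 S)
    rw [map_sum]
    exact Finset.sum_congr rfl fun S _ => by rw [map_smul, smul_eq_mul]
  have hli : LinearIndependent K N6 := by
    rw [Fintype.linearIndependent_iff]
    intro g hg
    have hz : g = 0 := by
      refine hκ g fun a ha l => ?_
      rw [← Blin (m a l) g, hg]
      simp [hB]
    exact fun S => congr_fun hz S
  set Nsp := Submodule.span K (Set.range N6) with hNsp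
  have hle : Nsp ≤ LinearMap.ker ψ := by
    rw [hNsp, Submodule.span_le]
    rintro _ ⟨S', rfl⟩
    rw [SetLike.mem_coe, LinearMap.mem_ker]
    funext S
    rw [hψ, Pi.zero_apply]
    exact iso6 S S'
  have hdim : finrank K Nsp = 6 := by
    rw [hNsp, finrank_span_eq_card hli, Fintype.card_fin]
  have hmono := Submodule.finrank_mono hle
  omega

end Summit.ValiantsHypothesis.ValiantsHypothesis.Theorems.SymPencilPerFourInnerRankHypNine

end
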